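import Literature.NumberTheory.LFunctions.CertifiedDirichletLTuringAbs
import Literature.NumberTheory.LFunctions.TuringMethodTrudgianNumericsCheck
import HarnessLib

/-!
# Turing's method for Dirichlet `L`-functions: the numerical bound, hypothesis-free

`CertifiedDirichletLTuringNumerics.lean` / `…Abs.lean` / `…Holds.lean` prove
`|∫_{t₁}^{t₂} S(t,χ)dt + ∫_{t₁}^{t₂} S(t,χ̄)dt| ≤ 2·(2.26 + 0.0642 log(qt₂/2π))` (`50 < t₁ ≤ t₂`, `χ`
primitive mod `q > 1`) granted the certified `ζ` computation `TrudgianNumerics.trudgianCheck = true`.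
That computation is evaluated once by `native_decide` in `TuringMethodTrudgianNumericsCheck.lean`
(`TrudgianNumerics.trudgianCheck_eq_true`; `214` certified Euler–Maclaurin values of `ζ`).  This file
plugs it in: the only non-standard axiom of the results below is that file's `native_decide` auxiliary
(trust in the Lean compiler) — a `computational` proposal, exactly like the `ζ` ladder's
`abs_integral_zetaArgS_le_trudgian_of_facts`.

* `TuringDirichlet.abs_integral_lfunctionArgS_pair_le_numeric'` — the two-sided numerical pair bound.
* `LFunctionRHUpTo.of_turing_numeric'` — the GRH-verification step for `χ` up to height `T > 50` from
  certified zero data and one decimal inequality.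

## References
* T. S. Trudgian, Improvements to Turing's method, Math. Comp. 80 (2011), §3.5, Theorem 3.3.
  [Trudgian2011]
* D. J. Platt, Math. Comp. 85 (2016), Theorem 3.2. [Platt2016GRH]
-/

noncomputable section

open Complex Set MeasureTheory intervalIntegral
open scoped Real

namespace Literature.NumberTheory.LFunctions

open DirichletCharacter ExplicitPsiChar TrudgianNumerics

namespace TuringDirichlet

variable {q : ℕ} [NeZero q] {χ : DirichletCharacter ℂ q}

/-- **Numerical Turing bound for Dirichlet `L`-functions (pair form, two-sided):** for a primitive `χ`
modulo `q > 1` and `50 < t₁ ≤ t₂`, `t₁`, `t₂` ordinates of no zero of `L(s,χ)` or `L(s,χ̄)` with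
`0 < Re s < 1`, `|∫_{t₁}^{t₂} S(t,χ) dt + ∫_{t₁}^{t₂} S(t,χ̄) dt| ≤ 2·(2.26 + 0.0642·log(qt₂/2π))`.
(Single-character printed comparators: Rumely 1993 Thm 2 `1.8397 + 0.1242 log`, Trudgian 2011 Thm 3.3
`1.975 + 0.084 log`.) [cite: Trudgian2011, §3.5 and Theorem 3.3] -/
theorem abs_integral_lfunctionArgS_pair_le_numeric' (hq : 1 < q) (hχ : χ.IsPrimitive) {t₁ t₂ : ℝ}
    (h01 : 50 < t₁) (h12 : t₁ ≤ t₂)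
    (hz₁ : ∀ ρ ∈ charNontrivialZeros χ, ρ.im ≠ t₁) (hz₁' : ∀ ρ ∈ charNontrivialZeros χ⁻¹, ρ.im ≠ t₁)
    (hz₂ : ∀ ρ ∈ charNontrivialZeros χ, ρ.im ≠ t₂) (hz₂' : ∀ ρ ∈ charNontrivialZeros χ⁻¹, ρ.im ≠ t₂) :
    |(∫ t in t₁..t₂, lfunctionArgS χ t) + ∫ t in t₁..t₂, lfunctionArgS χ⁻¹ t| ≤
      2 * (2.26 + 0.0642 * Real.log (q * t₂ / (2 * π))) :=
  abs_integral_lfunctionArgS_pair_le_numeric trudgianCheck_eq_true hq hχ h01 h12 hz₁ hz₁' hz₂ hz₂'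

end TuringDirichlet

open TuringDirichlet in
/-- **The GRH-verification step for `L(s,χ)` up to height `T > 50`** (Platt 2016 Thm. 3.2 with the
numerical Turing bound): for a primitive `χ` of conductor `q > 1`, `h > 0`, `±T`, `±(T+h)` ordinates of
no non-trivial zero of `L(s,χ)`, found zeros `W` (on the critical line, `|γ| ≤ T`, `#W = n`), `Z`, `Z'`
(on the line, ordinates in `(T, T+h]`, of `L(s,χ)`, `L(s,χ̄)`) and the single decimal inequality
`2(2.26 + 0.0642 log(q(T+h)/2π)) + (2/π)∫_T^{T+h} θ(t,χ)dt − Σ_Z(T+h−γ) − Σ_{Z'}(T+h−γ) < h(n+1)`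
certify `LFunctionRHUpTo χ T ∧ N_χ(T) = N_{χ,0}(T) = n`. [cite: Platt2016GRH, Theorem 3.2]
[cite: Trudgian2011, Theorem 3.3] -/
theorem LFunctionRHUpTo.of_turing_numeric' {q : ℕ} [NeZero q] {χ : DirichletCharacter ℂ q}
    (hχ : χ.IsPrimitive) (hq : 1 < q) {T h : ℝ} {n : ℕ} (hT : 50 < T) (hh : 0 < h)
    (hz : ∀ ρ ∈ charNontrivialZeros χ, ρ.im ≠ T ∧ ρ.im ≠ -T)
    (hzh : ∀ ρ ∈ charNontrivialZeros χ, ρ.im ≠ T + h ∧ ρ.im ≠ -(T + h))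
    (W : Finset ℝ) (hW : ∀ γ ∈ W, χ.LFunction (1 / 2 + γ * I) = 0 ∧ |γ| ≤ T) (hWn : W.card = n)
    (Z : Finset ℝ) (hZ : ∀ γ ∈ Z, χ.LFunction (1 / 2 + γ * I) = 0 ∧ T < γ ∧ γ ≤ T + h)
    (Z' : Finset ℝ) (hZ' : ∀ γ ∈ Z', χ⁻¹.LFunction (1 / 2 + γ * I) = 0 ∧ T < γ ∧ γ ≤ T + h)
    (hnum : 2 * (2.26 + 0.0642 * Real.log (q * (T + h) / (2 * π))) +
        2 / π * (∫ t in T..T + h, lfunctionTheta χ t) - ∑ γ ∈ Z, (T + h - γ) -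
        ∑ γ ∈ Z', (T + h - γ) < h * (n + 1)) :
    LFunctionRHUpTo χ T ∧ lfunctionZeroCount χ T = n ∧ lfunctionCriticalZeroCount χ T = n :=
  LFunctionRHUpTo.of_turing_numeric trudgianCheck_eq_true hχ hq hT hh hz hzh W hW hWn Z hZ Z' hZ' hnum

end Literature.NumberTheory.LFunctions

end
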